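import Literature.MathematicalPhysics.QuantumFieldTheory.Balaban1983to89.B4Ineq110LpChain
import Literature.MathematicalPhysics.QuantumFieldTheory.Balaban1983to89.B4Ineq19WalkRoute

/-!
# `Balaban1983to89.B4Ineq19LpChain` — [Balaban1983RegularityDecay] THEOREM (1.9)/(1.10): the HÖLDER member and the
# DERIVATIVE member FOR A GENERAL REGION `Ω` UNDER `dist({x,x′}, Ω^c) ≥ R₀`, by the printed mixed `L^p` chain
# (2.18)–(2.22) on the concrete operators (instances of `B4Ineq110LpChain.probe_bound_lp`)

statement-level skeleton of published theorems with citation tags; proofs where landed; nothing here is a claim about the Yang–Mills mass gap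

CITATION HEADER.  T. Bałaban, *Regularity and decay of lattice Green's functions*, Commun. Math. Phys. **89** (1983)
571–597, doi:10.1007/bf01214744 [Balaban1983RegularityDecay] (cell paper B4; held text
`paper:balaban1983-cmp89-regularity-decay`, journal page = PDF page + 570; pp. 572–573, 575–579).  Unit `lit-balaban-r01`
gen 6 (B4 fold owner), HOME `run/shared/lean/pub/lit-balaban/`, SKELETON rows **B4.Thm@573** ((1.9) Hölder member and
(1.10) derivative member, general `Ω`, `R₀`), **B4.Eq2.18**.  Theorems only; imports `B4Ineq110LpChain` (the chain with
convergence from the estimates, `probe_bound_lp`) and `B4Ineq19WalkRoute` (the Hölder probe algebra `holderOp_mul_mulH`,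
`fld_holderOp_mulVec`; through it `B4Ineq110WalkRouteDeriv`: `unitOp_mul_mulH`, `norm_unitOp_le`, `fld_bondOp_mulVec`).

WHAT IS PRINTED.  p. 573: *«|x − x′|^{−α}|U(A(Γ_{x,x′}))(D^η_{A,μ}G_k(Ω,A)f)(x′) − (D^η_{A,μ}G_k(Ω,A)f)(x)|
≤ c₀exp(−δ₀dist({x,x′}, supp f))‖f‖_∞ (1.9) for x, x′ ∈ Ω, and satisfying the condition dist({x,x′},Ω^c) ≥ R₀.
Similarly |(D^η_{A,μ}G_k(Ω,A)f)(x)|, |(G_k(Ω,A)f)(x)| ≤ c₀exp(−δ₀dist(x,supp f))‖f‖_∞ (1.10) for x ∈ Ω, dist(x,Ω^c) ≥ R₀.»*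
p. 578: *«If any of the points x, x′ belongs to supp h_j, then both belong to □_j and in the representation (2.13) for
each term we have that either both points belong to □_{ω₀}, or none. Of course the first situation occurs for at most
2^d cubes □_j. We restrict the summation in (2.13) to paths starting in the corresponding j's and we will prove the
inequality (1.9) using the representation (2.13): (the left hand side of (1.9)) ≤ Σ_ω ‖h_{ω₀}G_k(□_{ω₀},Ã_{ω₀})h_{ω₀}K_{ω₁}
⋯ f‖_{1,α,ω} (2.18) … We estimate the first sum using Lemma 2.2 by (2.20) … the second sum by (2.21)»*, p. 579 (2.22).

WHAT THIS MODULE PROVES (all in full; setting of `B4Ineq110LpChain.ineq110_value_lp`, inputs in the printed norms —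
sup and graded `‖·‖_{p₁/(i−1),p₁/i}` factor bounds at GOOD cubes, `L²` factor bound at ALL cubes, `3^dβ ≤ e⁻¹`, the `R₀`
condition in label form for the cubes seeing the probe's points).
* **`ineq110_deriv_lp`** — the bond `b = ⟨x,y⟩` (`|x − y|_∞ ≤ M/8`, `w ≥` the row `ℓ¹`-norms of `W(x,y)`), probe
  `P_b = E_{xy}[W(x,y)] − E_{xx}[1]`; first-letter inputs at good cubes `‖G_j‖ ≤ γ`, `‖P_bG_j‖ ≤ γ′` (Lemma 2.2 (2.17) sup
  members at `Ã_j`):  `‖P_b(G_k(Ω,A)f)‖_∞ ≤ 2^{d+2}e^{19/8}(γ′ + wγ)·V·e^{−D/M}‖f‖_∞`; `ineq110_deriv_lp_apply`: the printed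
  shape `|(W(x,y)(G_kf)(y) − (G_kf)(x))_k| ≤ …`.
* **`ineq19_holder_lp`** — the pair `x, x′` with bonds `b = ⟨x,y⟩`, `b′ = ⟨x′,y′⟩` (all within `M/8`), any `σ`
  (↦ `|x−x′|^{−α}`) and `U` (↦ `U(A(Γ_{x,x′}))`), probe `P_H = σ(E_{xy′}[UW(x′,y′)] − E_{xx′}[U] − (E_{xy}[W(x,y)] − E_{xx}[1]))`;
  Hölder input `‖P_H·h_jG_jh_j‖ ≤ γ_H` at good cubes (print: `c₁` via (2.16) and (2.3)/(2.4); reduced to inputs on `G_j`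
  itself by `B4Ineq19WalkRoute.norm_holderOp_letter_le`):  `‖P_H(G_k(Ω,A)f)‖_∞ ≤ 2^{d+3}e^{5/2}γ_H·V·e^{−D/M}‖f‖_∞`;
  `ineq19_holder_lp_apply`: the printed shape.
HONEST SCOPE.  As `B4Ineq110LpChain`: inputs are hypotheses in the printed norms; `R₀` through its label-space
consequence; `V` a parameter (`‖f‖₂ ≤ V‖f‖_∞`); `|x − x′| ≤ M/8` for the Hölder member (farther pairs: the derivative
member at `x` and at `x′`, as the print says p. 578); nothing about `α` or `U` is used.  No `def`, no `Prop` fact, no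
`sorry`; axioms standard.
-/

namespace Literature.MathematicalPhysics.QuantumFieldTheory.Balaban1983to89.B4Ineq19LpChain

open Literature.MathematicalPhysics.QuantumFieldTheory.Balaban1983to89.B4GaugeCovariance
open Literature.MathematicalPhysics.QuantumFieldTheory.Balaban1983to89.B4Commutators25to211
open Literature.MathematicalPhysics.QuantumFieldTheory.Balaban1983to89.B4PartitionUnity22
open Literature.MathematicalPhysics.QuantumFieldTheory.Balaban1983to89.B4RandomWalk213
open Literature.MathematicalPhysics.QuantumFieldTheory.Balaban1983to89.B4Eq26Locality
open Literature.MathematicalPhysics.QuantumFieldTheory.Balaban1983to89.B4Ineq110WalkRoute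
open Literature.MathematicalPhysics.QuantumFieldTheory.Balaban1983to89.B4Ineq110WalkRouteDeriv
open Literature.MathematicalPhysics.QuantumFieldTheory.Balaban1983to89.B4Ineq19WalkRoute
open Literature.MathematicalPhysics.QuantumFieldTheory.Balaban1983to89.B4Ineq110LpChain
open scoped Matrix NNReal
open scoped Matrix.Norms.Operator

section Route

variable {X Y κ : Type*} [Fintype X] [Fintype Y] [Fintype κ] [DecidableEq X] [DecidableEq κ] {d : ℕ}

/-- the labels that can see a site number at most `2^d`. [cite: Balaban1983RegularityDecay, §2 p.575] -/
private theorem card_labelBox_le (M : ℝ) (x : Fin d → ℝ) :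
    (Fintype.piFinset fun μ => ({⌊x μ / M⌋, ⌊x μ / M⌋ + 1} : Finset ℤ)).card ≤ 2 ^ d := by
  rw [Fintype.card_piFinset]
  calc ∏ μ, ({⌊x μ / M⌋, ⌊x μ / M⌋ + 1} : Finset ℤ).card ≤ 2 ^ (Finset.univ : Finset (Fin d)).card :=
        Finset.prod_le_pow_card _ _ 2 fun μ _ => Finset.card_le_two
    _ = 2 ^ d := by rw [Finset.card_univ, Fintype.card_fin]

/-- **[B4] THEOREM (1.10), DERIVATIVE MEMBER, GENERAL `Ω`, UNDER THE `R₀` CONDITION — by the mixed `L^p` chain.**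
Instance of `B4Ineq110LpChain.probe_bound_lp` with the bond-difference probe `P_b = E_{xy}[W(x,y)] − E_{xx}[1]` of the
bond `b = ⟨x,y⟩` (`|x−y|_∞ ≤ M/8`, `w ≥` the row `ℓ¹`-norms of `W(x,y)`): the probe annihilates `h_j` unless the cube
sees `x` or `y` (`≤ 2^{d+1}` cubes, within `(3/4)M` of `x`), and `‖P_b·h_jG_jh_j‖ ≤ γ′ + wγ` by
`P_b·h_j = h_j(x)P_b + (h_j(y) − h_j(x))E_{xy}[W]` from the inputs `‖G_j‖ ≤ γ`, `‖P_bG_j‖ ≤ γ′` at the good cubes.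
Conclusion, for `f` supported in `F × κ` with `‖f‖₂ ≤ V‖f‖_∞` and `D ≤ dist_∞(x,F)`:
`‖P_b(G_k(Ω,A)f)‖_∞ ≤ 2^{d+2}e^{19/8}(γ′ + wγ)·V·e^{−D/M}·‖f‖_∞`.
[cite: Balaban1983RegularityDecay, Theorem (1.10) p.573; (2.18)–(2.21) p.578; (2.22) p.579] -/
theorem ineq110_deriv_lp {M : ℝ} (hM : 0 < M) (pos : X → Fin d → ℝ) (c : X → X → ℝ) (m2 a : ℝ)
    (q : Y → X → ℝ) (W : X → X → Matrix κ κ ℝ) (T : Y → X → Matrix κ κ ℝ)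
    (hc : ∀ x z', c x z' ≠ 0 → ∀ μ, |pos x μ - pos z' μ| ≤ 1 / 8 * M)
    (hq : ∀ y x z', q y x ≠ 0 → q y z' ≠ 0 → ∀ μ, |pos x μ - pos z' μ| ≤ 1 / 8 * M)
    (s : Finset (Fin d → ℤ)) (hs : ∀ j x, hCube M j (pos x) ≠ 0 → j ∈ s)
    (S : (Fin d → ℤ) → X → Prop) [∀ j, DecidablePred (S j)]
    (hS : ∀ j z, (∀ μ, |pos z μ - M * j μ| ≤ 7 / 8 * M) → S j z)
    (W' : (Fin d → ℤ) → X → X → Matrix κ κ ℝ) (T' : (Fin d → ℤ) → Y → X → Matrix κ κ ℝ)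
    (hWW' : ∀ j x z', (∀ μ, |pos x μ - M * j μ| ≤ 3 / 4 * M) → (∀ μ, |pos z' μ - M * j μ| ≤ 3 / 4 * M) →
      W' j x z' = W x z')
    (hTT' : ∀ j y x, q y x ≠ 0 → (∀ μ, |pos x μ - M * j μ| ≤ 3 / 4 * M) → T' j y x = T y x)
    (Gj : (Fin d → ℤ) → Matrix (X × κ) (X × κ) ℝ)
    (hGj : ∀ j ∈ s, covOp (fun z z' => if (S j z ↔ S j z') then c z z' else 0) m2 a q (W' j) (T' j) * Gj j = 1)
    (G : Matrix (X × κ) (X × κ) ℝ) (hGH : G * covOp c m2 a q W T = 1)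
    -- the bond
    (x y : X) (hxy : ∀ μ, |pos x μ - pos y μ| ≤ 1 / 8 * M) {w : ℝ} (hw0 : 0 ≤ w)
    (hw : ∀ k, ∑ k', |W x y k k'| ≤ w)
    -- the interior cubes and the per-cube analytic inputs, in the printed norms
    (good : (Fin d → ℤ) → Prop) {γ γ' β ω : ℝ} {n₀ : ℕ} (hn₀ : 0 < n₀) (hω : 0 < ω) (hγ0 : 0 ≤ γ) (hγ'0 : 0 ≤ γ')
    (hβ0 : 0 ≤ β) (hγ : ∀ i : ↥s, good i.1 → ‖Gj i.1‖ ≤ γ)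
    (hγ' : ∀ i : ↥s, good i.1 → ‖(unitOp x y (W x y) - unitOp x x 1) * Gj i.1‖ ≤ γ')
    (h0 : ∀ i : ↥s, good i.1 → ‖opK (fun z z' => if (S i.1 z ↔ S i.1 z') then c z z' else 0) m2 a q (W' i.1) (T' i.1)
        (fun z => hCube M i.1 (pos z)) * Gj i.1 * mulH (ι := κ) (fun z => hCube M i.1 (pos z))‖ ≤ β)
    (hgr : ∀ i : ↥s, good i.1 → ∀ t : ℕ, 1 ≤ t → t ≤ n₀ → ∀ g : X × κ → ℝ,
      lvl ω n₀ (t - 1) ((opK (fun z z' => if (S i.1 z ↔ S i.1 z') then c z z' else 0) m2 a q (W' i.1) (T' i.1)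
        (fun z => hCube M i.1 (pos z)) * Gj i.1 * mulH (ι := κ) (fun z => hCube M i.1 (pos z))) *ᵥ g) ≤ β * lvl ω n₀ t g)
    (h2 : ∀ (i : ↥s) (g : X × κ → ℝ), lpv ω 2 ((opK (fun z z' => if (S i.1 z ↔ S i.1 z') then c z z' else 0) m2 a q (W' i.1) (T' i.1)
        (fun z => hCube M i.1 (pos z)) * Gj i.1 * mulH (ι := κ) (fun z => hCube M i.1 (pos z))) *ᵥ g) ≤ β * lpv ω 2 g)
    (h3β : (3 : ℝ) ^ d * β ≤ Real.exp (-1))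
    (hR₀ : ∀ i ∈ s, (hCube M i (pos x) ≠ 0 ∨ hCube M i (pos y) ≠ 0) →
      ∀ j ∈ s, (∀ μ, |i μ - j μ| ≤ (n₀ : ℤ)) → good j)
    -- the support set, its separation from `x`, the function
    (F : X → Prop) [DecidablePred F] {D : ℝ} (hD : ∀ x', F x' → ∃ μ, D ≤ |pos x μ - pos x' μ|)
    (f : X × κ → ℝ) (hfF : ∀ p : X × κ, ¬ F p.1 → f p = 0) {V : ℝ} (hV : 1 ≤ V) (hfV : lpv ω 2 f ≤ V * ‖f‖) :
    ‖(unitOp x y (W x y) - unitOp x x 1) *ᵥ (G *ᵥ f)‖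
      ≤ 2 ^ (d + 2) * Real.exp (19 / 8) * (γ' + w * γ) * V * Real.exp (-(D / M)) * ‖f‖ := by
  classical
  set h : (Fin d → ℤ) → X → ℝ := fun j z => hCube M j (pos z) with hh
  set aJ : (Fin d → ℤ) → Matrix (X × κ) (X × κ) ℝ :=
    fun j => mulH (ι := κ) (h j) * Gj j * mulH (ι := κ) (h j) with haJ
  set Pb : Matrix (X × κ) (X × κ) ℝ := unitOp x y (W x y) - unitOp x x 1 with hPbdef
  -- sizes
  have hh0 : ∀ j z, 0 ≤ h j z := fun j z => hCube_nonneg M j (pos z)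
  have hhle : ∀ j z, h j z ≤ 1 := fun j z => hCube_le_one M j (pos z)
  have hh1 : ∀ j z, |h j z| ≤ 1 := fun j z => abs_le.mpr ⟨by linarith [hh0 j z], hhle j z⟩
  have hnH : ∀ j, ‖mulH (ι := κ) (h j)‖ ≤ 1 := fun j => norm_mulH_le _ zero_le_one (hh1 j)
  have hnUW : ‖unitOp x y (W x y)‖ ≤ w := norm_unitOp_le x y _ hw0 hw
  -- `P_b·h_j = h_j(x)P_b + (h_j(y) − h_j(x))E_{xy}[W]`
  have hPbH : ∀ j, Pb * mulH (ι := κ) (h j) = h j x • Pb + (h j y - h j x) • unitOp x y (W x y) := by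
    intro j
    simp only [hPbdef, Matrix.sub_mul, unitOp_mul_mulH, smul_sub, sub_smul]
    abel
  -- the starting cubes: those seeing `x` or `y`
  set S₀ : Finset ↥s := Finset.univ.filter fun i : ↥s => h i.1 x ≠ 0 ∨ h i.1 y ≠ 0 with hS₀
  have hP0 : ∀ i : ↥s, i ∉ S₀ → Pb * mulH (ι := κ) (h i.1) = 0 := by
    intro i hi
    have hix : h i.1 x = 0 := by
      by_contra hne
      exact hi (Finset.mem_filter.mpr ⟨Finset.mem_univ _, Or.inl hne⟩)
    have hiy : h i.1 y = 0 := by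
      by_contra hne
      exact hi (Finset.mem_filter.mpr ⟨Finset.mem_univ _, Or.inr hne⟩)
    rw [hPbH i.1, hix, hiy, sub_zero, zero_smul, zero_smul, add_zero]
  have hcard : S₀.card ≤ 2 ^ (d + 1) := by
    have hsub : S₀.map (Function.Embedding.subtype (· ∈ s))
        ⊆ (Fintype.piFinset fun μ => ({⌊pos x μ / M⌋, ⌊pos x μ / M⌋ + 1} : Finset ℤ))
          ∪ (Fintype.piFinset fun μ => ({⌊pos y μ / M⌋, ⌊pos y μ / M⌋ + 1} : Finset ℤ)) := by
      intro j hj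
      obtain ⟨i, hi, rfl⟩ := Finset.mem_map.mp hj
      obtain ⟨-, hixy⟩ := Finset.mem_filter.mp hi
      rcases hixy with hix | hiy
      · exact Finset.mem_union_left _ (mem_box_of_hCube_ne_zero hix)
      · exact Finset.mem_union_right _ (mem_box_of_hCube_ne_zero hiy)
    calc S₀.card = (S₀.map (Function.Embedding.subtype (· ∈ s))).card := (Finset.card_map _).symm
      _ ≤ _ := Finset.card_le_card hsub
      _ ≤ _ := Finset.card_union_le _ _
      _ ≤ 2 ^ d + 2 ^ d := add_le_add (card_labelBox_le M (pos x)) (card_labelBox_le M (pos y))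
      _ = 2 ^ (d + 1) := by ring
  have hS₀ρ : ∀ i ∈ S₀, ∀ μ, |pos x μ - M * i.1 μ| < 3 / 4 * M := by
    intro i hi μ
    obtain ⟨-, hixy⟩ := Finset.mem_filter.mp hi
    rcases hixy with hix | hiy
    · exact (hCube_ne_zero_imp hM hix μ).trans (by nlinarith)
    · calc |pos x μ - M * i.1 μ| = |(pos x μ - pos y μ) + (pos y μ - M * i.1 μ)| := by ring_nf
        _ ≤ |pos x μ - pos y μ| + |pos y μ - M * i.1 μ| := abs_add_le _ _
        _ < 1 / 8 * M + 5 / 8 * M := add_lt_add_of_le_of_lt (hxy μ) (hCube_ne_zero_imp hM hiy μ)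
        _ = 3 / 4 * M := by ring
  have hgoodS₀ : ∀ i ∈ S₀, good i.1 := fun i hi =>
    hR₀ i.1 i.2 (Finset.mem_filter.mp hi).2 i.1 i.2 fun μ => by simp
  have hR₀' : ∀ i ∈ S₀, ∀ j : ↥s, (∀ μ, |i.1 μ - j.1 μ| ≤ (n₀ : ℤ)) → good j.1 :=
    fun i hi j hij => hR₀ i.1 i.2 (Finset.mem_filter.mp hi).2 j.1 j.2 hij
  -- the first-letter input `‖P_b·h_jG_jh_j‖ ≤ γ′ + wγ` at the starting cubes
  have hnPa : ∀ i ∈ S₀, ‖Pb * aJ i.1‖ ≤ γ' + w * γ := by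
    intro j hj
    have hsplit : Pb * aJ j.1 = h j.1 x • (Pb * Gj j.1 * mulH (ι := κ) (h j.1))
        + (h j.1 y - h j.1 x) • (unitOp x y (W x y) * Gj j.1 * mulH (ι := κ) (h j.1)) := by
      simp only [haJ]
      rw [← Matrix.mul_assoc, ← Matrix.mul_assoc, hPbH j.1, Matrix.add_mul, Matrix.add_mul, Matrix.smul_mul,
        Matrix.smul_mul, Matrix.smul_mul, Matrix.smul_mul]
    have hdiff : |h j.1 y - h j.1 x| ≤ 1 := by
      rw [abs_le]; constructor <;> linarith [hh0 j.1 y, hhle j.1 y, hh0 j.1 x, hhle j.1 x]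
    rw [hsplit]
    calc ‖h j.1 x • (Pb * Gj j.1 * mulH (ι := κ) (h j.1))
          + (h j.1 y - h j.1 x) • (unitOp x y (W x y) * Gj j.1 * mulH (ι := κ) (h j.1))‖
        ≤ ‖h j.1 x • (Pb * Gj j.1 * mulH (ι := κ) (h j.1))‖
          + ‖(h j.1 y - h j.1 x) • (unitOp x y (W x y) * Gj j.1 * mulH (ι := κ) (h j.1))‖ := norm_add_le _ _
      _ ≤ 1 * (γ' * 1) + 1 * ((w * γ) * 1) := by
          rw [norm_smul, norm_smul, Real.norm_eq_abs, Real.norm_eq_abs]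
          refine add_le_add (mul_le_mul (hh1 j.1 x) ?_ (norm_nonneg _) zero_le_one)
            (mul_le_mul hdiff ?_ (norm_nonneg _) zero_le_one)
          · exact (norm_mul_le _ _).trans
              (mul_le_mul (hγ' j (hgoodS₀ j hj)) (hnH j.1) (norm_nonneg _) hγ'0)
          · exact (norm_mul_le _ _).trans (mul_le_mul ((norm_mul_le _ _).trans
              (mul_le_mul hnUW (hγ j (hgoodS₀ j hj)) (norm_nonneg _) hw0)) (hnH j.1) (norm_nonneg _)
              (mul_nonneg hw0 hγ0))
      _ = γ' + w * γ := by ring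
  have hmain := probe_bound_lp hM pos c m2 a q W T hc hq s hs S hS W' T' hWW' hTT' Gj hGj G hGH Pb S₀ hcard hP0 x
    (ρ := 3 / 4) hS₀ρ good hn₀ hω (by positivity : 0 ≤ γ' + w * γ) hβ0 hnPa h0 hgr h2 h3β hR₀' F hD f hfF hV hfV
  calc ‖Pb *ᵥ (G *ᵥ f)‖
      ≤ 2 * ((2 ^ (d + 1) : ℕ) : ℝ) * (γ' + w * γ) * V * Real.exp (3 / 4 + 13 / 8) * Real.exp (-(D / M)) * ‖f‖ :=
        hmain
    _ = 2 ^ (d + 2) * Real.exp (19 / 8) * (γ' + w * γ) * V * Real.exp (-(D / M)) * ‖f‖ := by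
        push_cast
        rw [show (3 / 4 + 13 / 8 : ℝ) = 19 / 8 by norm_num]
        ring

/-- **(1.10) AS PRINTED, derivative member, general `Ω` under the `R₀` condition**: for `f` supported in `F × κ` with
`‖f‖₂ ≤ V‖f‖_∞`, every colour `k` and every `D ≤ dist_∞(x,F)`:
`|(W(x,y)(G_kf)(y) − (G_kf)(x))_k| ≤ 2^{d+2}e^{19/8}(γ′ + wγ)V·e^{−D/M}·‖f‖_∞` — the covariant bond difference (1.3) of
`G_k(Ω,A)f` at `b = ⟨x,y⟩` (the factor `η⁻¹` of `D^η` carried by the weights).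
[cite: Balaban1983RegularityDecay, Theorem (1.10) p.573, (1.3) p.572] -/
theorem ineq110_deriv_lp_apply {M : ℝ} (hM : 0 < M) (pos : X → Fin d → ℝ) (c : X → X → ℝ) (m2 a : ℝ)
    (q : Y → X → ℝ) (W : X → X → Matrix κ κ ℝ) (T : Y → X → Matrix κ κ ℝ)
    (hc : ∀ x z', c x z' ≠ 0 → ∀ μ, |pos x μ - pos z' μ| ≤ 1 / 8 * M)
    (hq : ∀ y x z', q y x ≠ 0 → q y z' ≠ 0 → ∀ μ, |pos x μ - pos z' μ| ≤ 1 / 8 * M)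
    (s : Finset (Fin d → ℤ)) (hs : ∀ j x, hCube M j (pos x) ≠ 0 → j ∈ s)
    (S : (Fin d → ℤ) → X → Prop) [∀ j, DecidablePred (S j)]
    (hS : ∀ j z, (∀ μ, |pos z μ - M * j μ| ≤ 7 / 8 * M) → S j z)
    (W' : (Fin d → ℤ) → X → X → Matrix κ κ ℝ) (T' : (Fin d → ℤ) → Y → X → Matrix κ κ ℝ)
    (hWW' : ∀ j x z', (∀ μ, |pos x μ - M * j μ| ≤ 3 / 4 * M) → (∀ μ, |pos z' μ - M * j μ| ≤ 3 / 4 * M) →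
      W' j x z' = W x z')
    (hTT' : ∀ j y x, q y x ≠ 0 → (∀ μ, |pos x μ - M * j μ| ≤ 3 / 4 * M) → T' j y x = T y x)
    (Gj : (Fin d → ℤ) → Matrix (X × κ) (X × κ) ℝ)
    (hGj : ∀ j ∈ s, covOp (fun z z' => if (S j z ↔ S j z') then c z z' else 0) m2 a q (W' j) (T' j) * Gj j = 1)
    (G : Matrix (X × κ) (X × κ) ℝ) (hGH : G * covOp c m2 a q W T = 1)
    (x y : X) (hxy : ∀ μ, |pos x μ - pos y μ| ≤ 1 / 8 * M) {w : ℝ} (hw0 : 0 ≤ w)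
    (hw : ∀ k, ∑ k', |W x y k k'| ≤ w)
    (good : (Fin d → ℤ) → Prop) {γ γ' β ω : ℝ} {n₀ : ℕ} (hn₀ : 0 < n₀) (hω : 0 < ω) (hγ0 : 0 ≤ γ) (hγ'0 : 0 ≤ γ')
    (hβ0 : 0 ≤ β) (hγ : ∀ i : ↥s, good i.1 → ‖Gj i.1‖ ≤ γ)
    (hγ' : ∀ i : ↥s, good i.1 → ‖(unitOp x y (W x y) - unitOp x x 1) * Gj i.1‖ ≤ γ')
    (h0 : ∀ i : ↥s, good i.1 → ‖opK (fun z z' => if (S i.1 z ↔ S i.1 z') then c z z' else 0) m2 a q (W' i.1) (T' i.1)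
        (fun z => hCube M i.1 (pos z)) * Gj i.1 * mulH (ι := κ) (fun z => hCube M i.1 (pos z))‖ ≤ β)
    (hgr : ∀ i : ↥s, good i.1 → ∀ t : ℕ, 1 ≤ t → t ≤ n₀ → ∀ g : X × κ → ℝ,
      lvl ω n₀ (t - 1) ((opK (fun z z' => if (S i.1 z ↔ S i.1 z') then c z z' else 0) m2 a q (W' i.1) (T' i.1)
        (fun z => hCube M i.1 (pos z)) * Gj i.1 * mulH (ι := κ) (fun z => hCube M i.1 (pos z))) *ᵥ g) ≤ β * lvl ω n₀ t g)
    (h2 : ∀ (i : ↥s) (g : X × κ → ℝ), lpv ω 2 ((opK (fun z z' => if (S i.1 z ↔ S i.1 z') then c z z' else 0) m2 a q (W' i.1) (T' i.1)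
        (fun z => hCube M i.1 (pos z)) * Gj i.1 * mulH (ι := κ) (fun z => hCube M i.1 (pos z))) *ᵥ g) ≤ β * lpv ω 2 g)
    (h3β : (3 : ℝ) ^ d * β ≤ Real.exp (-1))
    (hR₀ : ∀ i ∈ s, (hCube M i (pos x) ≠ 0 ∨ hCube M i (pos y) ≠ 0) →
      ∀ j ∈ s, (∀ μ, |i μ - j μ| ≤ (n₀ : ℤ)) → good j)
    (F : X → Prop) [DecidablePred F] {D : ℝ} (hD : ∀ x', F x' → ∃ μ, D ≤ |pos x μ - pos x' μ|)
    (f : X × κ → ℝ) (hfF : ∀ p : X × κ, ¬ F p.1 → f p = 0) {V : ℝ} (hV : 1 ≤ V) (hfV : lpv ω 2 f ≤ V * ‖f‖)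
    (k : κ) :
    |(W x y *ᵥ fld (G *ᵥ f) y - fld (G *ᵥ f) x) k|
      ≤ 2 ^ (d + 2) * Real.exp (19 / 8) * (γ' + w * γ) * V * Real.exp (-(D / M)) * ‖f‖ := by
  have hmain := ineq110_deriv_lp hM pos c m2 a q W T hc hq s hs S hS W' T' hWW' hTT' Gj hGj G hGH x y hxy hw0 hw
    good hn₀ hω hγ0 hγ'0 hβ0 hγ hγ' h0 hgr h2 h3β hR₀ F hD f hfF hV hfV
  have hentry : ((unitOp x y (W x y) - unitOp x x 1) *ᵥ (G *ᵥ f)) (x, k)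
      = (W x y *ᵥ fld (G *ᵥ f) y - fld (G *ᵥ f) x) k := by
    rw [← fld_apply ((unitOp x y (W x y) - unitOp x x 1) *ᵥ (G *ᵥ f)) x k, fld_bondOp_mulVec]
  rw [← hentry, ← Real.norm_eq_abs]
  exact (norm_le_pi_norm _ (x, k)).trans hmain

/-- **[B4] THEOREM (1.9), HÖLDER MEMBER, GENERAL `Ω`, UNDER THE `R₀` CONDITION — by the mixed `L^p` chain.**
Instance of `B4Ineq110LpChain.probe_bound_lp` with the Hölder probe
`P_H = σ·(E_{xy′}[UW(x′,y′)] − E_{xx′}[U] − (E_{xy}[W(x,y)] − E_{xx}[1]))` of `B4Ineq19WalkRoute` (pair `x, x′`, bonds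
`b = ⟨x,y⟩`, `b′ = ⟨x′,y′⟩`, all within `M/8`; any real `σ` ↦ `|x−x′|^{−α}`, any `U` ↦ `U(A(Γ_{x,x′}))`): the probe
annihilates `h_j` unless the cube sees one of `x, y, x′, y′` (`≤ 2^{d+2}` cubes, within `(7/8)M` of `x` — *«If any of
the points x, x′ belongs to supp h_j, then both belong to □_j … at most 2^d cubes»*), with the per-cube HÖLDER input
`‖P_H·h_jG_jh_j‖ ≤ γ_H` at the good cubes (print: `c₁`, from (2.16) via (2.3)/(2.4)).  Conclusion, for `f` supported in
`F × κ` with `‖f‖₂ ≤ V‖f‖_∞` and `D ≤ dist_∞(x,F)`:  `‖P_H(G_k(Ω,A)f)‖_∞ ≤ 2^{d+3}e^{5/2}γ_H·V·e^{−D/M}·‖f‖_∞`.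
[cite: Balaban1983RegularityDecay, Theorem (1.9) p.573; (2.14) p.577; (2.18)–(2.21) p.578; (2.22) p.579] -/
theorem ineq19_holder_lp {M : ℝ} (hM : 0 < M) (pos : X → Fin d → ℝ) (c : X → X → ℝ) (m2 a : ℝ)
    (q : Y → X → ℝ) (W : X → X → Matrix κ κ ℝ) (T : Y → X → Matrix κ κ ℝ)
    (hc : ∀ x z', c x z' ≠ 0 → ∀ μ, |pos x μ - pos z' μ| ≤ 1 / 8 * M)
    (hq : ∀ y x z', q y x ≠ 0 → q y z' ≠ 0 → ∀ μ, |pos x μ - pos z' μ| ≤ 1 / 8 * M)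
    (s : Finset (Fin d → ℤ)) (hs : ∀ j x, hCube M j (pos x) ≠ 0 → j ∈ s)
    (S : (Fin d → ℤ) → X → Prop) [∀ j, DecidablePred (S j)]
    (hS : ∀ j z, (∀ μ, |pos z μ - M * j μ| ≤ 7 / 8 * M) → S j z)
    (W' : (Fin d → ℤ) → X → X → Matrix κ κ ℝ) (T' : (Fin d → ℤ) → Y → X → Matrix κ κ ℝ)
    (hWW' : ∀ j x z', (∀ μ, |pos x μ - M * j μ| ≤ 3 / 4 * M) → (∀ μ, |pos z' μ - M * j μ| ≤ 3 / 4 * M) →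
      W' j x z' = W x z')
    (hTT' : ∀ j y x, q y x ≠ 0 → (∀ μ, |pos x μ - M * j μ| ≤ 3 / 4 * M) → T' j y x = T y x)
    (Gj : (Fin d → ℤ) → Matrix (X × κ) (X × κ) ℝ)
    (hGj : ∀ j ∈ s, covOp (fun z z' => if (S j z ↔ S j z') then c z z' else 0) m2 a q (W' j) (T' j) * Gj j = 1)
    (G : Matrix (X × κ) (X × κ) ℝ) (hGH : G * covOp c m2 a q W T = 1)
    -- the pair of points, the two bonds, the Hölder weight and the transport
    (x y x' y' : X) (hxy : ∀ μ, |pos x μ - pos y μ| ≤ 1 / 8 * M) (hxx' : ∀ μ, |pos x μ - pos x' μ| ≤ 1 / 8 * M)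
    (hx'y' : ∀ μ, |pos x' μ - pos y' μ| ≤ 1 / 8 * M) (σ : ℝ) (U : Matrix κ κ ℝ)
    -- the interior cubes and the per-cube analytic inputs, in the printed norms
    (good : (Fin d → ℤ) → Prop) {γH β ω : ℝ} {n₀ : ℕ} (hn₀ : 0 < n₀) (hω : 0 < ω) (hγH0 : 0 ≤ γH) (hβ0 : 0 ≤ β)
    (hγH : ∀ i : ↥s, good i.1 → ‖σ • (unitOp x y' (U * W x' y') - unitOp x x' U - (unitOp x y (W x y) - unitOp x x 1))
        * (mulH (ι := κ) (fun z => hCube M i.1 (pos z)) * Gj i.1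
        * mulH (ι := κ) (fun z => hCube M i.1 (pos z)))‖ ≤ γH)
    (h0 : ∀ i : ↥s, good i.1 → ‖opK (fun z z' => if (S i.1 z ↔ S i.1 z') then c z z' else 0) m2 a q (W' i.1) (T' i.1)
        (fun z => hCube M i.1 (pos z)) * Gj i.1 * mulH (ι := κ) (fun z => hCube M i.1 (pos z))‖ ≤ β)
    (hgr : ∀ i : ↥s, good i.1 → ∀ t : ℕ, 1 ≤ t → t ≤ n₀ → ∀ g : X × κ → ℝ,
      lvl ω n₀ (t - 1) ((opK (fun z z' => if (S i.1 z ↔ S i.1 z') then c z z' else 0) m2 a q (W' i.1) (T' i.1)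
        (fun z => hCube M i.1 (pos z)) * Gj i.1 * mulH (ι := κ) (fun z => hCube M i.1 (pos z))) *ᵥ g) ≤ β * lvl ω n₀ t g)
    (h2 : ∀ (i : ↥s) (g : X × κ → ℝ), lpv ω 2 ((opK (fun z z' => if (S i.1 z ↔ S i.1 z') then c z z' else 0) m2 a q (W' i.1) (T' i.1)
        (fun z => hCube M i.1 (pos z)) * Gj i.1 * mulH (ι := κ) (fun z => hCube M i.1 (pos z))) *ᵥ g) ≤ β * lpv ω 2 g)
    (h3β : (3 : ℝ) ^ d * β ≤ Real.exp (-1))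
    (hR₀ : ∀ i ∈ s, (hCube M i (pos x) ≠ 0 ∨ hCube M i (pos y) ≠ 0 ∨ hCube M i (pos x') ≠ 0
      ∨ hCube M i (pos y') ≠ 0) → ∀ j ∈ s, (∀ μ, |i μ - j μ| ≤ (n₀ : ℤ)) → good j)
    -- the support set, its separation from `x`, the function
    (F : X → Prop) [DecidablePred F] {D : ℝ} (hD : ∀ x'', F x'' → ∃ μ, D ≤ |pos x μ - pos x'' μ|)
    (f : X × κ → ℝ) (hfF : ∀ p : X × κ, ¬ F p.1 → f p = 0) {V : ℝ} (hV : 1 ≤ V) (hfV : lpv ω 2 f ≤ V * ‖f‖) :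
    ‖(σ • (unitOp x y' (U * W x' y') - unitOp x x' U - (unitOp x y (W x y) - unitOp x x 1))) *ᵥ (G *ᵥ f)‖
      ≤ 2 ^ (d + 3) * Real.exp (5 / 2) * γH * V * Real.exp (-(D / M)) * ‖f‖ := by
  classical
  set h : (Fin d → ℤ) → X → ℝ := fun j z => hCube M j (pos z) with hh
  -- the starting cubes: those seeing one of `x, y, x′, y′`
  set S₀ : Finset ↥s := Finset.univ.filter fun i : ↥s =>
    h i.1 x ≠ 0 ∨ h i.1 y ≠ 0 ∨ h i.1 x' ≠ 0 ∨ h i.1 y' ≠ 0 with hS₀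
  have hcard : S₀.card ≤ 2 ^ (d + 2) := by
    have hsub : S₀.map (Function.Embedding.subtype (· ∈ s))
        ⊆ ((Fintype.piFinset fun μ => ({⌊pos x μ / M⌋, ⌊pos x μ / M⌋ + 1} : Finset ℤ))
          ∪ (Fintype.piFinset fun μ => ({⌊pos y μ / M⌋, ⌊pos y μ / M⌋ + 1} : Finset ℤ)))
          ∪ ((Fintype.piFinset fun μ => ({⌊pos x' μ / M⌋, ⌊pos x' μ / M⌋ + 1} : Finset ℤ))
          ∪ (Fintype.piFinset fun μ => ({⌊pos y' μ / M⌋, ⌊pos y' μ / M⌋ + 1} : Finset ℤ))) := by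
      intro j hj
      obtain ⟨i, hi, rfl⟩ := Finset.mem_map.mp hj
      obtain ⟨-, hi4⟩ := Finset.mem_filter.mp hi
      rcases hi4 with h1 | h2 | h3 | h4
      · exact Finset.mem_union_left _ (Finset.mem_union_left _ (mem_box_of_hCube_ne_zero h1))
      · exact Finset.mem_union_left _ (Finset.mem_union_right _ (mem_box_of_hCube_ne_zero h2))
      · exact Finset.mem_union_right _ (Finset.mem_union_left _ (mem_box_of_hCube_ne_zero h3))
      · exact Finset.mem_union_right _ (Finset.mem_union_right _ (mem_box_of_hCube_ne_zero h4))
    calc S₀.card = (S₀.map (Function.Embedding.subtype (· ∈ s))).card := (Finset.card_map _).symm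
      _ ≤ _ := Finset.card_le_card hsub
      _ ≤ _ := Finset.card_union_le _ _
      _ ≤ (2 ^ d + 2 ^ d) + (2 ^ d + 2 ^ d) :=
          add_le_add ((Finset.card_union_le _ _).trans (add_le_add (card_labelBox_le M (pos x))
            (card_labelBox_le M (pos y)))) ((Finset.card_union_le _ _).trans (add_le_add
            (card_labelBox_le M (pos x')) (card_labelBox_le M (pos y'))))
      _ = 2 ^ (d + 2) := by ring
  have hP0 : ∀ i : ↥s, i ∉ S₀ → (σ • (unitOp x y' (U * W x' y') - unitOp x x' U - (unitOp x y (W x y) - unitOp x x 1))) * mulH (ι := κ) (h i.1) = 0 := by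
    intro i hi
    have hz : ∀ z, (z = x ∨ z = y ∨ z = x' ∨ z = y') → h i.1 z = 0 := by
      intro z hz
      by_contra hne
      apply hi
      refine Finset.mem_filter.mpr ⟨Finset.mem_univ _, ?_⟩
      rcases hz with rfl | rfl | rfl | rfl
      · exact Or.inl hne
      · exact Or.inr (Or.inl hne)
      · exact Or.inr (Or.inr (Or.inl hne))
      · exact Or.inr (Or.inr (Or.inr hne))
    rw [holderOp_mul_mulH, hz x (Or.inl rfl), hz y (Or.inr (Or.inl rfl)), hz x' (Or.inr (Or.inr (Or.inl rfl))),
      hz y' (Or.inr (Or.inr (Or.inr rfl)))]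
    simp
  have hS₀ρ : ∀ i ∈ S₀, ∀ μ, |pos x μ - M * i.1 μ| < 7 / 8 * M := by
    intro i hi μ
    obtain ⟨-, hi4⟩ := Finset.mem_filter.mp hi
    have hnear : ∀ z, (∀ ν, |pos x ν - pos z ν| ≤ 2 / 8 * M) → h i.1 z ≠ 0 →
        |pos x μ - M * i.1 μ| < 7 / 8 * M := by
      intro z hz hiz
      calc |pos x μ - M * i.1 μ| = |(pos x μ - pos z μ) + (pos z μ - M * i.1 μ)| := by ring_nf
        _ ≤ |pos x μ - pos z μ| + |pos z μ - M * i.1 μ| := abs_add_le _ _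
        _ < 2 / 8 * M + 5 / 8 * M := add_lt_add_of_le_of_lt (hz μ) (hCube_ne_zero_imp hM hiz μ)
        _ = 7 / 8 * M := by ring
    rcases hi4 with h1 | h2 | h3 | h4
    · exact hnear x (fun ν => by rw [sub_self, abs_zero]; positivity) h1
    · exact hnear y (fun ν => (hxy ν).trans (by nlinarith)) h2
    · exact hnear x' (fun ν => (hxx' ν).trans (by nlinarith)) h3
    · refine hnear y' (fun ν => ?_) h4
      calc |pos x ν - pos y' ν| = |(pos x ν - pos x' ν) + (pos x' ν - pos y' ν)| := by ring_nf
        _ ≤ |pos x ν - pos x' ν| + |pos x' ν - pos y' ν| := abs_add_le _ _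
        _ ≤ 1 / 8 * M + 1 / 8 * M := add_le_add (hxx' ν) (hx'y' ν)
        _ = 2 / 8 * M := by ring
  have hgoodS₀ : ∀ i ∈ S₀, good i.1 := fun i hi =>
    hR₀ i.1 i.2 (Finset.mem_filter.mp hi).2 i.1 i.2 fun μ => by simp
  have hR₀' : ∀ i ∈ S₀, ∀ j : ↥s, (∀ μ, |i.1 μ - j.1 μ| ≤ (n₀ : ℤ)) → good j.1 :=
    fun i hi j hij => hR₀ i.1 i.2 (Finset.mem_filter.mp hi).2 j.1 j.2 hij
  have hαP : ∀ i ∈ S₀, ‖(σ • (unitOp x y' (U * W x' y') - unitOp x x' U - (unitOp x y (W x y) - unitOp x x 1)))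
      * (mulH (ι := κ) (h i.1) * Gj i.1 * mulH (ι := κ) (h i.1))‖ ≤ γH := fun i hi => hγH i (hgoodS₀ i hi)
  have hmain := probe_bound_lp hM pos c m2 a q W T hc hq s hs S hS W' T' hWW' hTT' Gj hGj G hGH
    (σ • (unitOp x y' (U * W x' y') - unitOp x x' U - (unitOp x y (W x y) - unitOp x x 1))) S₀ hcard hP0 x
    (ρ := 7 / 8) hS₀ρ good hn₀ hω hγH0 hβ0 hαP h0 hgr h2 h3β hR₀' F hD f hfF hV hfV
  calc _ ≤ 2 * ((2 ^ (d + 2) : ℕ) : ℝ) * γH * V * Real.exp (7 / 8 + 13 / 8) * Real.exp (-(D / M)) * ‖f‖ := hmain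
    _ = 2 ^ (d + 3) * Real.exp (5 / 2) * γH * V * Real.exp (-(D / M)) * ‖f‖ := by
        push_cast
        rw [show (7 / 8 + 13 / 8 : ℝ) = 5 / 2 by norm_num]
        ring

/-- **(1.9) AS PRINTED, general `Ω` under the `R₀` condition**: for `f` supported in `F × κ` with `‖f‖₂ ≤ V‖f‖_∞`,
`D ≤ dist_∞(x,F)`, every colour component of the transported Hölder difference of the covariant bond differences of
`G_k(Ω,A)f` obeys `|σ·(U(W(x′,y′)(Gf)(y′) − (Gf)(x′)) − (W(x,y)(Gf)(y) − (Gf)(x)))_k| ≤ 2^{d+3}e^{5/2}γ_HV·e^{−D/M}·‖f‖_∞`.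
[cite: Balaban1983RegularityDecay, Theorem (1.9) p.573] -/
theorem ineq19_holder_lp_apply {M : ℝ} (hM : 0 < M) (pos : X → Fin d → ℝ) (c : X → X → ℝ) (m2 a : ℝ)
    (q : Y → X → ℝ) (W : X → X → Matrix κ κ ℝ) (T : Y → X → Matrix κ κ ℝ)
    (hc : ∀ x z', c x z' ≠ 0 → ∀ μ, |pos x μ - pos z' μ| ≤ 1 / 8 * M)
    (hq : ∀ y x z', q y x ≠ 0 → q y z' ≠ 0 → ∀ μ, |pos x μ - pos z' μ| ≤ 1 / 8 * M)
    (s : Finset (Fin d → ℤ)) (hs : ∀ j x, hCube M j (pos x) ≠ 0 → j ∈ s)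
    (S : (Fin d → ℤ) → X → Prop) [∀ j, DecidablePred (S j)]
    (hS : ∀ j z, (∀ μ, |pos z μ - M * j μ| ≤ 7 / 8 * M) → S j z)
    (W' : (Fin d → ℤ) → X → X → Matrix κ κ ℝ) (T' : (Fin d → ℤ) → Y → X → Matrix κ κ ℝ)
    (hWW' : ∀ j x z', (∀ μ, |pos x μ - M * j μ| ≤ 3 / 4 * M) → (∀ μ, |pos z' μ - M * j μ| ≤ 3 / 4 * M) →
      W' j x z' = W x z')
    (hTT' : ∀ j y x, q y x ≠ 0 → (∀ μ, |pos x μ - M * j μ| ≤ 3 / 4 * M) → T' j y x = T y x)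
    (Gj : (Fin d → ℤ) → Matrix (X × κ) (X × κ) ℝ)
    (hGj : ∀ j ∈ s, covOp (fun z z' => if (S j z ↔ S j z') then c z z' else 0) m2 a q (W' j) (T' j) * Gj j = 1)
    (G : Matrix (X × κ) (X × κ) ℝ) (hGH : G * covOp c m2 a q W T = 1)
    (x y x' y' : X) (hxy : ∀ μ, |pos x μ - pos y μ| ≤ 1 / 8 * M) (hxx' : ∀ μ, |pos x μ - pos x' μ| ≤ 1 / 8 * M)
    (hx'y' : ∀ μ, |pos x' μ - pos y' μ| ≤ 1 / 8 * M) (σ : ℝ) (U : Matrix κ κ ℝ)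
    (good : (Fin d → ℤ) → Prop) {γH β ω : ℝ} {n₀ : ℕ} (hn₀ : 0 < n₀) (hω : 0 < ω) (hγH0 : 0 ≤ γH) (hβ0 : 0 ≤ β)
    (hγH : ∀ i : ↥s, good i.1 → ‖σ • (unitOp x y' (U * W x' y') - unitOp x x' U - (unitOp x y (W x y) - unitOp x x 1))
        * (mulH (ι := κ) (fun z => hCube M i.1 (pos z)) * Gj i.1
        * mulH (ι := κ) (fun z => hCube M i.1 (pos z)))‖ ≤ γH)
    (h0 : ∀ i : ↥s, good i.1 → ‖opK (fun z z' => if (S i.1 z ↔ S i.1 z') then c z z' else 0) m2 a q (W' i.1) (T' i.1)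
        (fun z => hCube M i.1 (pos z)) * Gj i.1 * mulH (ι := κ) (fun z => hCube M i.1 (pos z))‖ ≤ β)
    (hgr : ∀ i : ↥s, good i.1 → ∀ t : ℕ, 1 ≤ t → t ≤ n₀ → ∀ g : X × κ → ℝ,
      lvl ω n₀ (t - 1) ((opK (fun z z' => if (S i.1 z ↔ S i.1 z') then c z z' else 0) m2 a q (W' i.1) (T' i.1)
        (fun z => hCube M i.1 (pos z)) * Gj i.1 * mulH (ι := κ) (fun z => hCube M i.1 (pos z))) *ᵥ g) ≤ β * lvl ω n₀ t g)
    (h2 : ∀ (i : ↥s) (g : X × κ → ℝ), lpv ω 2 ((opK (fun z z' => if (S i.1 z ↔ S i.1 z') then c z z' else 0) m2 a q (W' i.1) (T' i.1)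
        (fun z => hCube M i.1 (pos z)) * Gj i.1 * mulH (ι := κ) (fun z => hCube M i.1 (pos z))) *ᵥ g) ≤ β * lpv ω 2 g)
    (h3β : (3 : ℝ) ^ d * β ≤ Real.exp (-1))
    (hR₀ : ∀ i ∈ s, (hCube M i (pos x) ≠ 0 ∨ hCube M i (pos y) ≠ 0 ∨ hCube M i (pos x') ≠ 0
      ∨ hCube M i (pos y') ≠ 0) → ∀ j ∈ s, (∀ μ, |i μ - j μ| ≤ (n₀ : ℤ)) → good j)
    (F : X → Prop) [DecidablePred F] {D : ℝ} (hD : ∀ x'', F x'' → ∃ μ, D ≤ |pos x μ - pos x'' μ|)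
    (f : X × κ → ℝ) (hfF : ∀ p : X × κ, ¬ F p.1 → f p = 0) {V : ℝ} (hV : 1 ≤ V) (hfV : lpv ω 2 f ≤ V * ‖f‖)
    (k : κ) :
    |(σ • (U *ᵥ (W x' y' *ᵥ fld (G *ᵥ f) y' - fld (G *ᵥ f) x')
        - (W x y *ᵥ fld (G *ᵥ f) y - fld (G *ᵥ f) x))) k|
      ≤ 2 ^ (d + 3) * Real.exp (5 / 2) * γH * V * Real.exp (-(D / M)) * ‖f‖ := by
  have hmain := ineq19_holder_lp hM pos c m2 a q W T hc hq s hs S hS W' T' hWW' hTT' Gj hGj G hGH x y x' y' hxy hxx'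
    hx'y' σ U good hn₀ hω hγH0 hβ0 hγH h0 hgr h2 h3β hR₀ F hD f hfF hV hfV
  have hentry : ((σ • (unitOp x y' (U * W x' y') - unitOp x x' U - (unitOp x y (W x y) - unitOp x x 1))) *ᵥ (G *ᵥ f)) (x, k)
      = (σ • (U *ᵥ (W x' y' *ᵥ fld (G *ᵥ f) y' - fld (G *ᵥ f) x')
        - (W x y *ᵥ fld (G *ᵥ f) y - fld (G *ᵥ f) x))) k := by
    rw [← fld_apply ((σ • (unitOp x y' (U * W x' y') - unitOp x x' U - (unitOp x y (W x y) - unitOp x x 1))) *ᵥ (G *ᵥ f)) x k, fld_holderOp_mulVec]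
  rw [← hentry, ← Real.norm_eq_abs]
  exact (norm_le_pi_norm _ (x, k)).trans hmain

end Route

end Literature.MathematicalPhysics.QuantumFieldTheory.Balaban1983to89.B4Ineq19LpChain
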